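/-
Copyright (c) 2026. All rights reserved.
Released under Apache 2.0 license as described in the file LICENSE.
Authors: abc-iut cell, discharge seat abc-iut-w4-d095 (wave 4, gen 3).
-/
import Mathlib.Algebra.Category.Grp.Preadditive
import Mathlib.CategoryTheory.Preadditive.FunctorCategory
import Literature.AnabelianGeometry.AbsoluteAnabelian.LogFrobeniusLogWallPlusOfObstruction
import HarnessLib

/-!
# [AbsTopIII] Corollary 5.5 (iv), first sentence (`⊞`-half): the typed log-wall `Cor55Incompatibility` HOLDS at an explicit setting — kernel non-vacuity of FACT-LIST row F-0141 and of the antecedent of `cor55Incompatibility_of_archObstruction`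

S. Mochizuki, *Topics in absolute anabelian geometry III: global reconstruction algorithms*,
J. Math. Sci. Univ. Tokyo 22 (2015) 939–1156 [MochizukiAbsTopIII2015]; locators `p.N` = pages of the
author's manuscript (`paper:url-5493eb38cbb7`): Def 5.4 (v), (vii) pp. 127–128; Cor 5.5 (iv) p. 131 ("`D•_{≤2}` does
not admit a structure of core on `D•_{≤1}` which is compatible with the observables `S_log`, `S_log⊞`"); Lemma 4.4 /
Cor 4.5 (iv) pp. 106–110 (the archimedean mechanism: `k ⥲ k~ ↠ k^× ↪ k` is not the identity).

PROOF-ONLY companion of `LogFrobeniusCorollaries.lean` (the `Prop` `LogFrobeniusSetting.Cor55Incompatibility`, abc-iut-L4-t3;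
FACT-LIST F-0141) and `LogFrobeniusLogWallPlusOfObstruction.lean` (abc-iut-w5-d097: `Cor55Incompatibility` ⟸ an
archimedean CYCLE OBSTRUCTION at one place `v₀` — "for no isomorphism `a : x₀ ⥲ log(x₀)` is
`λ⊞_{sl}(a) ≫ ι⊞_{ε₁} ≫ ι⊞_{ε₂} ≫ ι⊞_{ε₃}` the identity").  Two kernel facts about these TYPED statements:

* `LogFrobeniusSetting.exists_cor55Incompatibility_of_preadditive` / `…exists_cor55Incompatibility`: over every index
  set with at least one ARCHIMEDEAN place `v₀` (`isArc v₀ = true`), there is a setting `L` at which the cycle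
  obstruction — hence, by abc-iut-w5-d097's theorem, the typed log-wall `L.Cor55Incompatibility` — HOLDS.  The witness
  is the "zero-twisted diagonal setting" on a preadditive large category `C` with an object `x₀` with `𝟙 x₀ ≠ 0`
  (all rows `C`, all structure functors `𝟭 C`, all equivalences `refl`, all 2-cells identities — as in
  `LogFrobeniusSettingNonVacuity.lean` — EXCEPT that every `ι⊞_{v,ε}` is the ZERO natural transformation);
  instantiated at `C := AddCommGrpCat.{u}`, `x₀ := ℤ`.  So F-0141 is SATISFIABLE together with the interface (it is
  not refutable from the typing), and the antecedent of `cor55Incompatibility_of_archObstruction` is satisfiable (that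
  conditional reduction is not vacuous).
* `LogFrobeniusSetting.exists_not_archObstruction`: at the plain diagonal setting (`ι⊞_{v,ε}` the identity
  identifications) the cycle obstruction FAILS at every place and every object (`a := 𝟙`, the three `ι⊞`-components
  are identities up to the canonical casts, composite `= 𝟙`): the antecedent is a genuine condition on `L`, not a
  consequence of the interface.  (Whether the CONCLUSION `Cor55Incompatibility` also fails at the diagonal setting —
  full independence of F-0141 — needs a core-plus-observables family of homotopies there; not in this file.)

HONEST LABEL: both settings are DEGENERATE consistency witnesses (no arithmetic content; zero `ι⊞` is not print's
`ι⊞`, which is induced by the arrows `k~ ↠ k^× ↪ k` of Def 5.4 (v)); they calibrate the typed statements, nothing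
more.  Refereed pre-IUT anabelian geometry; nothing here bears on [IUTchIII] Cor. 3.12; typed ≠ proved.
-/

universe u

open CategoryTheory

namespace Literature.AnabelianGeometry.AbsoluteAnabelian

namespace LogFrobeniusSetting

section ZeroTwist

variable {C : Type (u + 1)} [Category.{u} C]

/-- `Λ_ν ∘ 𝟭 = 𝟭` for `log = 𝟭` (both values of the Boolean "is the post-log vertex").
[cite: MochizukiAbsTopIII2015, Def 5.4 (vii) p. 128] -/
private theorem frobeniusTwist_id_comp_id (b : Bool) : frobeniusTwist (𝟭 C) b ⋙ 𝟭 C = 𝟭 C := by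
  cases b <;> rfl

/-- An identity is `HEq` to the `eqToHom` of any equation of objects ending at its object (cast bookkeeping for the
components of the diagonal setting's `ι⊞`). [folklore] -/
private theorem heq_id_eqToHom {y x : C} (h : y = x) : HEq (𝟙 x) (eqToHom h) := by
  subst h
  rfl

variable [Preadditive C]

/-- In a preadditive category: a morphism `m : x ⟶ x` that is `HEq` to the component at `x` of the ZERO natural
transformation `F ⟶ G` between functors equal to the identity is zero (the cast bookkeeping behind the zero-twisted
witness). [folklore] -/
private theorem eq_zero_of_heq_app_zero {F G : C ⥤ C} (hF : F = 𝟭 C) (hG : G = 𝟭 C) (x : C) (m : x ⟶ x)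
    (h : HEq m ((0 : F ⟶ G).app x)) : m = 0 := by
  subst hF hG
  rw [NatTrans.app_zero] at h
  exact eq_of_heq h

end ZeroTwist

variable (Vmod : Type u) (isArc : Vmod → Bool)

/-- **The typed log-wall holds at the zero-twisted diagonal setting.**  For a preadditive large category `C`, an object
`x₀` with `𝟙 x₀ ≠ 0` and an archimedean place `v₀`: the setting with all rows `C`, all structure functors `𝟭 C`, all
2-cells identities and every `ι⊞_{v,ε} := 0` satisfies abc-iut-w5-d097's archimedean cycle obstruction at `x₀` (the middle
component `ι⊞_{ε₂}` of any candidate composite is `0`, so the composite is `0 ≠ 𝟙 x₀`), hence `Cor55Incompatibility`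
(Cor 5.5 (iv), first sentence, `⊞`-half, FACT-LIST F-0141) — a NON-VACUITY witness for that typed statement and for the
antecedent of `cor55Incompatibility_of_archObstruction`.  DEGENERATE by design (module docstring).
[cite: MochizukiAbsTopIII2015, Cor 5.5 (iv) p. 131] -/
theorem exists_cor55Incompatibility_of_preadditive (C : Type (u + 1)) [Category.{u} C] [Preadditive C] (x₀ : C)
    (hx₀ : (𝟙 x₀ : x₀ ⟶ x₀) ≠ 0) (v₀ : Vmod) (hv₀ : isArc v₀ = true) :
    ∃ L : LogFrobeniusSetting Vmod isArc, L.X = C ∧ L.Cor55Incompatibility := by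
  let L₀ : LogFrobeniusSetting Vmod isArc :=
    { X := C
      E := C
      proj := 𝟭 C
      log := 𝟭 C
      logIsoId := Iso.refl _
      logOver := Iso.refl _
      Nplus := fun _ => C
      N := fun _ => C
      forget := fun _ => 𝟭 C
      toE := fun _ => 𝟭 C
      lam := fun _ _ => 𝟭 C
      lamOver := fun _ _ => Iso.refl _
      lam_spaceLink_eq_postLog := fun _ => rfl
      iota := fun _ _ _ _ => 0
      An := C
      κAn := CategoryTheory.Equivalence.refl
      φAn := 𝟭 C
      φAn_isEquivalence := inferInstance
      ηAn := Iso.refl _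
      κAn₂ := CategoryTheory.Equivalence.refl
      Emono := C
      monoAn := 𝟭 C
      NmonoPlus := fun _ => C
      Nmono := fun _ => C
      forgetMono := fun _ => 𝟭 C
      toEmono := fun _ => 𝟭 C
      monoNplus := fun _ => 𝟭 C
      monoN := fun _ => 𝟭 C
      monoHomotopy := fun _ => Iso.refl _
      AnMono := C
      κAnMono := CategoryTheory.Equivalence.refl
      ψAnMono := fun _ _ => 𝟭 C }
  refine ⟨L₀, rfl, ?_⟩
  refine L₀.cor55Incompatibility_of_archObstruction v₀ hv₀ x₀ ?_
  intro ν₂ νₘ _ _ ε₁ ε₂ ε₃ a _ m₁ m₂ m₃ _ hm₂ _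
  have h₂ : m₂ = 0 :=
    eq_zero_of_heq_app_zero (frobeniusTwist_id_comp_id (C := C) ν₂.isPostLog) rfl x₀ m₂ hm₂
  rw [h₂, Limits.zero_comp, Limits.comp_zero, Limits.comp_zero]
  exact fun h => hx₀ h.symm

/-- **`Cor55Incompatibility` (F-0141) is satisfiable over every index set with an archimedean place**: the zero-twisted
diagonal setting on the category of abelian groups `AddCommGrpCat.{u}` with `x₀ := ℤ` (`𝟙_ℤ ≠ 0`).
[cite: MochizukiAbsTopIII2015, Cor 5.5 (iv) p. 131] -/
theorem exists_cor55Incompatibility (v₀ : Vmod) (hv₀ : isArc v₀ = true) :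
    ∃ L : LogFrobeniusSetting Vmod isArc, L.Cor55Incompatibility := by
  have hx₀ : (𝟙 (AddCommGrpCat.of (ULift.{u} ℤ)) : _ ⟶ _) ≠ 0 := by
    intro h
    have h1 := congrArg (fun f : AddCommGrpCat.of (ULift.{u} ℤ) ⟶ AddCommGrpCat.of (ULift.{u} ℤ) =>
      (f.hom (ULift.up 1)).down) h
    simp at h1
  obtain ⟨L, -, hL⟩ :=
    exists_cor55Incompatibility_of_preadditive Vmod isArc AddCommGrpCat.{u} _ hx₀ v₀ hv₀
  exact ⟨L, hL⟩

/-- **The archimedean cycle obstruction FAILS at the plain diagonal setting** (all `ι⊞_{v,ε}` the identity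
identifications `Λ_ν ∘ 𝟭 = 𝟭`): for every large category `C`, at the diagonal setting on `C`, at EVERY place `v₀`,
EVERY object `x₀` and every triple of edges, the candidate composite with `a := 𝟙` and the `ι⊞`-components IS the
identity — so the antecedent of `cor55Incompatibility_of_archObstruction` is a genuine condition on the setting, not a
consequence of the interface. [cite: MochizukiAbsTopIII2015, Cor 5.5 (iv) p. 131] -/
theorem exists_not_archObstruction (C : Type (u + 1)) [Category.{u} C] :
    ∃ L : LogFrobeniusSetting Vmod isArc, L.X = C ∧ ∀ (v₀ : Vmod) (x₀ : L.X) (ν₂ νₘ : LogVertex (isArc v₀))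
      (ε₁ : LogEdge (isArc v₀) (LogVertex.postLog (isArc v₀)) ν₂) (ε₂ : LogEdge (isArc v₀) ν₂ νₘ)
      (ε₃ : LogEdge (isArc v₀) νₘ (LogVertex.spaceLink (isArc v₀))),
      ∃ (a : x₀ ⟶ L.log.obj x₀) (_ : IsIso a)
        (m₁ : (L.lam v₀ (LogVertex.spaceLink (isArc v₀))).obj (L.log.obj x₀) ⟶ (L.lam v₀ ν₂).obj x₀)
        (m₂ : (L.lam v₀ ν₂).obj x₀ ⟶ (L.lam v₀ νₘ).obj x₀)
        (m₃ : (L.lam v₀ νₘ).obj x₀ ⟶ (L.lam v₀ (LogVertex.spaceLink (isArc v₀))).obj x₀),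
        HEq m₁ ((L.iota v₀ ε₁).app x₀) ∧ HEq m₂ ((L.iota v₀ ε₂).app x₀) ∧ HEq m₃ ((L.iota v₀ ε₃).app x₀) ∧
          (L.lam v₀ (LogVertex.spaceLink (isArc v₀))).map a ≫ m₁ ≫ m₂ ≫ m₃ = 𝟙 _ := by
  -- componentwise: the `ι⊞` of the diagonal setting is `eqToHom` of `Λ_ν ∘ 𝟭 = 𝟭`, whose component at `x₀` is an
  -- `eqToHom` between (propositionally) equal objects, i.e. `HEq` to `𝟙 x₀`
  have twist_eq : ∀ b : Bool, frobeniusTwist (𝟭 C) b ⋙ 𝟭 C = 𝟭 C := fun b => by cases b <;> rfl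
  have heq_id_app : ∀ (b : Bool) (x₀ : C),
      HEq (𝟙 x₀) ((eqToHom (twist_eq b) : frobeniusTwist (𝟭 C) b ⋙ 𝟭 C ⟶ 𝟭 C).app x₀) := by
    intro b x₀
    rw [eqToHom_app]
    exact heq_id_eqToHom (Functor.congr_obj (twist_eq b) x₀)
  let L₀ : LogFrobeniusSetting Vmod isArc :=
    { X := C
      E := C
      proj := 𝟭 C
      log := 𝟭 C
      logIsoId := Iso.refl _
      logOver := Iso.refl _
      Nplus := fun _ => C
      N := fun _ => C
      forget := fun _ => 𝟭 C
      toE := fun _ => 𝟭 C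
      lam := fun _ _ => 𝟭 C
      lamOver := fun _ _ => Iso.refl _
      lam_spaceLink_eq_postLog := fun _ => rfl
      iota := fun _ ν₁ _ _ => eqToHom (twist_eq ν₁.isPostLog)
      An := C
      κAn := CategoryTheory.Equivalence.refl
      φAn := 𝟭 C
      φAn_isEquivalence := inferInstance
      ηAn := Iso.refl _
      κAn₂ := CategoryTheory.Equivalence.refl
      Emono := C
      monoAn := 𝟭 C
      NmonoPlus := fun _ => C
      Nmono := fun _ => C
      forgetMono := fun _ => 𝟭 C
      toEmono := fun _ => 𝟭 C
      monoNplus := fun _ => 𝟭 C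
      monoN := fun _ => 𝟭 C
      monoHomotopy := fun _ => Iso.refl _
      AnMono := C
      κAnMono := CategoryTheory.Equivalence.refl
      ψAnMono := fun _ _ => 𝟭 C }
  refine ⟨L₀, rfl, fun v₀ x₀ ν₂ νₘ ε₁ ε₂ ε₃ => ?_⟩
  refine ⟨𝟙 x₀, IsIso.id x₀, 𝟙 x₀, 𝟙 x₀, 𝟙 x₀, heq_id_app _ x₀, heq_id_app _ x₀, heq_id_app _ x₀, ?_⟩
  change 𝟙 x₀ ≫ 𝟙 x₀ ≫ 𝟙 x₀ ≫ 𝟙 x₀ = 𝟙 x₀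
  simp

end LogFrobeniusSetting

end Literature.AnabelianGeometry.AbsoluteAnabelian
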